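import Mathlib
import Summits.ValiantsHypothesis.ValiantsHypothesis.Theses.ValuativeGCT
import Summits.ValiantsHypothesis.ValiantsHypothesis.Theses.GCTMult
import Summits.ValiantsHypothesis.ValiantsHypothesis.Theorems.ValuativeGCTValuativeFlipBottomWindow

/-!
# `ValuativeGCT.ValuativeFlip` (stmt-ValiantsHypothesis-12624) is its padded part, and implies the
# classical multiplicity flip

Line `skew-restriction-rank` for crux `ValuativeGCT.ValuativeFlip` (route-ValiantsHypothesis-ValuativeGCT), third
line lead, 2026-08-16.  Two sorry-free pieces of logic that fix the crux's position:

* `valuativeFlip_iff_aboveBottom` — the crux (∀ c, eventually in n, for every m in the quasi-polynomial window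
  `n ≤ m ≤ 2^((log₂ n + c)^c)` some valuative truncation `T_U(λ)` drops below `mult_{λ*} ℂ[Δ_m(X₀₀^{m-n} per_n)]`)
  is EQUIVALENT to the same statement with `n ≤ m` sharpened to `n < m`, because the bottom `m = n` of every window
  is a theorem (`valuativeFlip_cruxBody_bottom`, file `ValuativeGCTValuativeFlipBottomWindow`: the Hilbert-function
  count, landed stubs B1–B6 of this line).  So the content of the crux is exactly the PADDED range `n < m`.
* `gctMultFlip_of_valuativeFlip` — given the route's `ValuativeBound` (stmt-12625: `K_m(λ*) ≤ dim T_U(λ)`), the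
  crux implies the classical Mulmuley–Sohoni multiplicity flip `GCTMult.GctMultFlip` (stmt-0887:
  `K_m(χ) < mult_pp(χ)` for some weight `χ` at every window position), with `χ = λ*`.  Pure logic.

Together with `valuativeFlip_of_gctKroneckerFlip` (H3a, file `ValuativeGCTValuativeFlipKroneckerCensus` once the
Kronecker bound `dim T₀(λ) ≤ g(λ, m×δ, m×δ)` lands) this sandwiches the crux formally between the two classical flips:
`GctKroneckerFlip (0888) ⇒ ValuativeFlip (12624) ⇔ ValuativeFlip above the bottom ⇒ (with 12625) GctMultFlip (0887)`.

Sources: K. Mulmuley, M. Sohoni, SIAM J. Comput. 31 (2001) §4–5 and 38 (2008); BLMW, SIAM J. Comput. 40 (2011)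
§5.2; this line (`Cruxes/ValuativeFlip/Lines/skew-restriction-rank.lean`).
-/

set_option linter.dupNamespace false

namespace Summit.ValiantsHypothesis.ValiantsHypothesis.Theorems.ValuativeFlip

open scoped BigOperators Matrix
open Literature.NumberTheory.DiophantineGeometry
open Literature.Computability.AlgebraicComplexity
open Summit.ValiantsHypothesis.ValiantsHypothesis.Theses.ValuativeGCT

noncomputable section

/-- **The crux is its padded part.**  `ValuativeFlip` is equivalent to the same statement with `n ≤ m` replaced
by `n < m` (body verbatim the route decl's): `→` forgets the bottom; `←` takes `n₀ := max n₀ 3` and serves the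
bottom `m = n` by `valuativeFlip_cruxBody_bottom` (no-cut centre `U = ⊥`, `r = 0`; Hilbert-function count).
[Mulmuley–Sohoni 2001 §4–5; BLMW 2011 §5.2; this line] -/
theorem valuativeFlip_iff_aboveBottom :
    Summit.ValiantsHypothesis.ValiantsHypothesis.Theses.ValuativeGCT.ValuativeFlip ↔
      ∀ c : ℕ, ∃ n₀ : ℕ, ∀ n ≥ n₀, ∀ (m : ℕ) [NeZero m], n < m → m ≤ 2 ^ ((Nat.log 2 n + c) ^ c) →
        ∃ (U : Submodule ℂ (MatIdx m → ℂ)) (r δ : ℕ) (lam : Nat.Partition (m * δ)),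
          (∀ u ∈ U, (Matrix.of fun a b : Fin m => u (toLex (a, b))).rank ≤ r) ∧ lam.parts.card ≤ m * m ∧
            Module.finrank ℂ ↥(MvPolynomial.homogeneousSubmodule (MatIdx m × MatIdx m) ℂ (m * δ) ⊓
                ((MvPolynomial.vanishingIdeal ℂ
                    {p : MatIdx m × MatIdx m → ℂ | ∀ j : MatIdx m, (fun i => p (j, i)) ∈ U}) ^ (δ * (m - r))).restrictScalars ℂ ⊓
                (⨅ (M : Matrix (MatIdx m) (MatIdx m) ℂ)
                  (_ : linSubst (MatIdx m) ℂ M (detFormLex ℂ m) = detFormLex ℂ m),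
                  LinearMap.ker ((MvPolynomial.aeval fun p : MatIdx m × MatIdx m =>
                      ∑ l : MatIdx m, M l p.2 •
                        (MvPolynomial.X (p.1, l) : MvPolynomial (MatIdx m × MatIdx m) ℂ)).toLinearMap -
                    (LinearMap.id : MvPolynomial (MatIdx m × MatIdx m) ℂ →ₗ[ℂ] MvPolynomial (MatIdx m × MatIdx m) ℂ))) ⊓
                (⨅ (g : Matrix.GeneralLinearGroup (MatIdx m) ℂ) (_ : IsUpperTriangular g),
                  LinearMap.ker ((MvPolynomial.aeval fun p : MatIdx m × MatIdx m =>
                      ∑ l : MatIdx m, ((g⁻¹ : Matrix.GeneralLinearGroup (MatIdx m) ℂ) :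
                        Matrix (MatIdx m) (MatIdx m) ℂ) p.1 l •
                          (MvPolynomial.X (l, p.2) : MvPolynomial (MatIdx m × MatIdx m) ℂ)).toLinearMap -
                    weightChar ((Weight.dualOfPartition (m * m) lam).toMatIdx : Weight (MatIdx m)) g •
                      (LinearMap.id : MvPolynomial (MatIdx m × MatIdx m) ℂ →ₗ[ℂ] MvPolynomial (MatIdx m × MatIdx m) ℂ)))) <
              orbitMultiplicity ℂ (paddedPerFormLex ℂ n m) m
                ((Weight.dualOfPartition (m * m) lam).toMatIdx : Weight (MatIdx m)) := by
  constructor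
  · intro h c
    obtain ⟨n₀, hn₀⟩ := h c
    exact ⟨n₀, fun n hn m _ hnm hm => hn₀ n hn m hnm.le hm⟩
  · intro h c
    obtain ⟨n₀, hn₀⟩ := h c
    refine ⟨max n₀ 3, fun n hn m _ hnm hm => ?_⟩
    have hn₀' : n₀ ≤ n := le_of_max_le_left hn
    have hn3 : 3 ≤ n := le_of_max_le_right hn
    rcases hnm.eq_or_lt with rfl | hlt'
    · exact valuativeFlip_cruxBody_bottom n hn3
    · exact hn₀ n hn₀' m hlt' hm

/-- **The crux implies the classical multiplicity flip.**  Given the route's `ValuativeBound` (stmt-12625,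
`K_m(λ*) ≤ dim T_U(λ)` for every admissible centre), a `ValuativeFlip` witness `(U, r, δ, λ)` at `(n, m)` gives
`K_m(λ*) ≤ dim T_U(λ) < mult_{λ*} ℂ[Δ_m(X₀₀^{m-n} per_n)]`, i.e. the weight `χ := λ*` witnesses
`GCTMult.GctMultFlip` (stmt-ValiantsHypothesis-0887) at `(n, m)`.  Pure logic (the route's `closes` minus its last two
steps).  [Mulmuley–Sohoni 2008; BLMW 2011 §3.3; this line] -/
theorem gctMultFlip_of_valuativeFlip
    (hB : Summit.ValiantsHypothesis.ValiantsHypothesis.Theses.ValuativeGCT.ValuativeBound)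
    (hF : Summit.ValiantsHypothesis.ValiantsHypothesis.Theses.ValuativeGCT.ValuativeFlip) :
    Summit.ValiantsHypothesis.ValiantsHypothesis.Theses.GCTMult.GctMultFlip := by
  intro c
  obtain ⟨n₀, hn₀⟩ := hF c
  refine ⟨n₀, fun n hn m _ hnm hm => ?_⟩
  obtain ⟨U, r, δ, lam, hU, hcard, hlt⟩ := hn₀ n hn m hnm hm
  exact ⟨_, lt_of_le_of_lt (hB m U r hU δ lam hcard) hlt⟩

end

end Summit.ValiantsHypothesis.ValiantsHypothesis.Theorems.ValuativeFlip
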